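import Literature.MathematicalPhysics.QuantumLattice.FalkBruchHyperbolicFloor
import Mathlib.Analysis.SpecialFunctions.Log.Deriv
import Mathlib.Analysis.Convex.Jensen
import Mathlib.Analysis.Convex.SpecificFunctions.Basic
import HarnessLib

/-!
# Roepstorff's floor on the Duhamel two-point function: `b ≥ g · (1 − e^{−u})/u`, `u = βc/(4g)`

Topic `Literature/MathematicalPhysics/QuantumLattice` (sibling of `DuhamelTwoPoint.lean` and
`FalkBruchHyperbolicFloor.lean`; same objects `Matrix.duhamel`, `Matrix.duhamelKernel`,
`Matrix.gibbsState` and the pair-sum representations of [DLS1978] (35)).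

With `g = ⟨A²⟩_β`, `b = (A, A)_β` (Duhamel), `c = ⟨[A,[H,A]]⟩_β ≥ 0` for a Hermitian observable `A`,
Dyson–Lieb–Simon prove the Falk–Bruch inequality `b ≥ g f(βc/4g)` with the implicit convex function
`f(t tanh t) = t⁻¹ tanh t` [DLS1978, Thm. 3.1], and record [DLS1978, §3 Remark 3, eqs. (36)–(37);
App. A Thm. A.4, (A10)] that ROEPSTORFF's earlier inequality [Roepstorff1976] is the same statement
with `f` replaced by the explicit smaller function

  `f_R(u) = u⁻¹ (1 − e^{−u}) ≤ f(u)`.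

This file proves Roepstorff's inequality for Gibbs states of Hermitian matrices,

  `g · f_R(βc/4g) ≤ b`   (`Matrix.IsHermitian.gibbsState_sq_mul_roepstorff_le_duhamel`,
  family form `Matrix.roepstorff_sum_le`),

writing `f_R(u)` as the tree's own `Matrix.duhamelKernel u 0 1 = ∫₀¹ e^{−σu} dσ` (no new definition).
`f_R` sharpens the hyperbolic floor `1/(1+u)` of `FalkBruchHyperbolicFloor.lean` (`f_R(u) ≥ 1/(1+u)`
since `e^u ≥ 1 + u`) and is within `9 %` of the sharp `f` everywhere, within `1 %` for `u ≥ 5`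
(`f_R/f` at `u = ½, 1, 2, 3, 5, 10`: `0.94, 0.91, 0.92, 0.96, 0.993, 0.9999` [arith]).

Proof (the DLS route, [DLS1978] proof of Prop. 3.1 with `f_R` for `f`): per pair of eigenvalues the
claim `((wᵢ+wⱼ)/2)·f_R(u_{ij}) ≤ K_{ij}` with `u_{ij} = βc_{ij}/(4·(wᵢ+wⱼ)/2) = s tanh s`,
`s = β(Eⱼ−Eᵢ)/2`, is EQUIVALENT to `s tanh s ≤ 2 log cosh s` (`Matrix.mul_tanh_le_two_mul_log_cosh`,
by `d/ds (2 log cosh s − s tanh s) = (sinh s cosh s − s)/cosh² s ≥ 0`); the pairs are then summed with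
Jensen's inequality for `exp` INSIDE the integral `f_R(u) = ∫₀¹ e^{−σu} dσ` (Mathlib `convexOn_exp`),
which replaces the convexity of `f_R`. No new definition, no named fact.

Cell `pub/hubbard-tc` (D-0154 (1) thermal line, route «hubbard-tc-thermcert-1» K1, Falk–Bruch door:
hub-tc-therm-crit-1 06:06:40Z priced the hyperbolic floor's loss for low-frequency words and asked for
the sharp form there; `f_R` closes that gap to ≤ 1 % for `u ≥ 5`). WHAT THIS IS NOT: the sharp implicit
`f` (convexity of `f` itself is not formalised); anything about the Hubbard model or a temperature.

## References

* [Roepstorff1976] G. Roepstorff, *Correlation inequalities in quantum statistical mechanics and their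
  application in the Kondo problem*, Comm. Math. Phys. **46** (1976) 253–262 (the bound `b ≥ g f_R(c/4g)`
  for `A = A*`, as reported in [DLS1978] §3 Remark 3).
* [DLS1978] F. J. Dyson, E. H. Lieb, B. Simon, J. Stat. Phys. **18** (1978) 335–383, §3 Thm. 3.1,
  Prop. 3.1, Remark 3 (36)–(37); Appendix A, Thm. A.4 (A10)–(A11).
-/

noncomputable section

open scoped Matrix.Norms.L2Operator ComplexOrder
open Finset MeasureTheory intervalIntegral

namespace Matrix

variable {n : Type*} [Fintype n] [DecidableEq n]

/-! ### The scalar inequality `s tanh s ≤ 2 log cosh s` -/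

/-- The auxiliary function `φ(s) = 2 log cosh s − s tanh s` has derivative
`tanh s − s/cosh² s`. [folklore] -/
private theorem hasDerivAt_two_log_cosh_sub (s : ℝ) :
    HasDerivAt (fun s : ℝ => 2 * Real.log (Real.cosh s) - s * (Real.sinh s / Real.cosh s))
      (Real.sinh s / Real.cosh s - s / Real.cosh s ^ 2) s := by
  have hcosh : Real.cosh s ≠ 0 := (Real.cosh_pos s).ne'
  have h1 : HasDerivAt (fun s => Real.log (Real.cosh s)) (Real.sinh s / Real.cosh s) s :=
    (Real.hasDerivAt_cosh s).log hcosh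
  have h2 : HasDerivAt (fun s => Real.sinh s / Real.cosh s)
      ((Real.cosh s * Real.cosh s - Real.sinh s * Real.sinh s) / Real.cosh s ^ 2) s :=
    (Real.hasDerivAt_sinh s).div (Real.hasDerivAt_cosh s) hcosh
  have h3 : HasDerivAt (fun s : ℝ => s * (Real.sinh s / Real.cosh s))
      (1 * (Real.sinh s / Real.cosh s) +
        s * ((Real.cosh s * Real.cosh s - Real.sinh s * Real.sinh s) / Real.cosh s ^ 2)) s :=
    (hasDerivAt_id' s).mul h2
  have h4 := (h1.const_mul 2).sub h3
  refine h4.congr_deriv ?_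
  have hsq : Real.cosh s * Real.cosh s - Real.sinh s * Real.sinh s = 1 := by
    nlinarith [Real.cosh_sq_sub_sinh_sq s]
  rw [hsq]
  field_simp
  ring

/-- `s·tanh s ≤ 2 log cosh s` for all real `s` (written with `sinh/cosh`): the function
`φ(s) = 2 log cosh s − s tanh s` has `φ(0) = 0`, is even, and `φ'(s) = (sinh s cosh s − s)/cosh² s ≥ 0`
for `s ≥ 0`. This is the two-level content of [DLS1978] Thm. A.4 `f(x) ≥ x⁻¹(1 − e^{−x})` (their (A11)).
[cite: DLS1978, App. A Thm. A.4 (A10)–(A11)] -/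
theorem mul_tanh_le_two_mul_log_cosh (s : ℝ) :
    s * (Real.sinh s / Real.cosh s) ≤ 2 * Real.log (Real.cosh s) := by
  -- `φ' ≥ 0` on `s > 0`
  have hφ'_nonneg : ∀ s : ℝ, 0 < s → 0 ≤ Real.sinh s / Real.cosh s - s / Real.cosh s ^ 2 := by
    intro s hs
    have hc := Real.cosh_pos s
    have h2s : 2 * s ≤ Real.sinh (2 * s) := Real.self_le_sinh_iff.2 (by linarith)
    rw [Real.sinh_two_mul] at h2s
    have hkey : s ≤ Real.sinh s * Real.cosh s := by linarith
    have : Real.sinh s / Real.cosh s - s / Real.cosh s ^ 2 =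
        (Real.sinh s * Real.cosh s - s) / Real.cosh s ^ 2 := by
      field_simp
    rw [this]
    exact div_nonneg (by linarith) (sq_nonneg _)
  -- monotone on `[0, ∞)`
  have hmono : MonotoneOn (fun s : ℝ => 2 * Real.log (Real.cosh s) - s * (Real.sinh s / Real.cosh s))
      (Set.Ici 0) := by
    refine monotoneOn_of_hasDerivWithinAt_nonneg (convex_Ici 0)
      (fun x _ => (hasDerivAt_two_log_cosh_sub x).continuousAt.continuousWithinAt)
      (f' := fun s => Real.sinh s / Real.cosh s - s / Real.cosh s ^ 2) ?_ ?_
    · intro x _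
      exact (hasDerivAt_two_log_cosh_sub x).hasDerivWithinAt
    · intro x hx
      rw [interior_Ici] at hx
      exact hφ'_nonneg x hx
  -- nonnegativity on `[0, ∞)`
  have hmain : ∀ s : ℝ, 0 ≤ s → s * (Real.sinh s / Real.cosh s) ≤ 2 * Real.log (Real.cosh s) := by
    intro s hs
    have h := hmono (Set.mem_Ici.2 le_rfl) (Set.mem_Ici.2 hs) hs
    simp only [Real.cosh_zero, Real.log_one, mul_zero, Real.sinh_zero, zero_div, sub_zero] at h
    linarith
  -- even function
  rcases le_total 0 s with hs | hs
  · exact hmain s hs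
  · have h := hmain (-s) (by linarith)
    rw [Real.cosh_neg, Real.sinh_neg] at h
    have : -s * (-Real.sinh s / Real.cosh s) = s * (Real.sinh s / Real.cosh s) := by ring
    linarith [this]

/-! ### Roepstorff's function as a Duhamel kernel -/

/-- `f_R(u) = ∫₀¹ e^{−σu} dσ` is the tree's Duhamel kernel `K_u(0,1)`. [cite: DLS1978, §3 Remark 3 eq. (36)] -/
theorem duhamelKernel_zero_one_eq (u : ℝ) :
    duhamelKernel u 0 1 = ∫ σ in (0 : ℝ)..1, Real.exp (-(u * σ)) := by
  unfold duhamelKernel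
  refine intervalIntegral.integral_congr fun σ _ => ?_
  simp only [mul_one, mul_zero, add_zero, mul_comm u σ]

/-- `u · f_R(u) = 1 − e^{−u}`. [cite: DLS1978, §3 Remark 3 eq. (36)] -/
theorem mul_duhamelKernel_zero_one (u : ℝ) :
    u * duhamelKernel u 0 1 = 1 - Real.exp (-u) := by
  have h := exp_sub_exp_eq_mul_duhamelKernel u 0 1
  simp only [mul_zero, neg_zero, Real.exp_zero, mul_one, sub_zero] at h
  linarith

/-- `f_R(0) = 1`. [cite: DLS1978, §3 Remark 3 eq. (36)] -/
theorem duhamelKernel_zero_zero_one : duhamelKernel 0 0 1 = 1 := by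
  rw [duhamelKernel_zero_one_eq]
  simp

/-! ### The per-pair Roepstorff inequality -/

/-- **Per pair**: with `a = e^{-βx}`, `b = e^{-βy}`, `K = K_β(x,y)`, `c = (y−x)(a−b)` and
`u = βc/(4·(a+b)/2)` (`= s tanh s`, `s = β(y−x)/2`): `((a+b)/2) · f_R(u) ≤ K`. Equivalent to
`s tanh s ≤ 2 log cosh s` (`mul_tanh_le_two_mul_log_cosh`). [cite: DLS1978, App. A Thm. A.4 (A10); §3 Remark 3 (37)]
[cite: Roepstorff1976, main inequality (as reported in DLS1978 §3 Remark 3)] -/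
theorem half_add_mul_roepstorff_le_duhamelKernel (β x y : ℝ) :
    (Real.exp (-(β * x)) + Real.exp (-(β * y))) / 2 *
        duhamelKernel (β * ((y - x) * (Real.exp (-(β * x)) - Real.exp (-(β * y)))) /
          (4 * ((Real.exp (-(β * x)) + Real.exp (-(β * y))) / 2))) 0 1 ≤
      duhamelKernel β x y := by
  -- parametrisation `a = G e^{s}`, `b = G e^{-s}`
  set G : ℝ := Real.exp (-(β * (x + y) / 2)) with hGdef
  set s : ℝ := (β * y - β * x) / 2 with hs
  have hGpos : 0 < G := Real.exp_pos _
  have ha : Real.exp (-(β * x)) = G * Real.exp s := by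
    rw [hGdef, ← Real.exp_add]; congr 1; rw [hs]; ring
  have hb : Real.exp (-(β * y)) = G * Real.exp (-s) := by
    rw [hGdef, ← Real.exp_add]; congr 1; rw [hs]; ring
  have hsum : Real.exp (-(β * x)) + Real.exp (-(β * y)) = 2 * G * Real.cosh s := by
    rw [ha, hb, Real.cosh_eq]; ring
  have hdiff : Real.exp (-(β * x)) - Real.exp (-(β * y)) = 2 * G * Real.sinh s := by
    rw [ha, hb, Real.sinh_eq]; ring
  have h2s : β * (y - x) = 2 * s := by rw [hs]; ring
  have hcosh := Real.cosh_pos s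
  -- the argument `u = s tanh s`
  set u : ℝ := β * ((y - x) * (Real.exp (-(β * x)) - Real.exp (-(β * y)))) /
      (4 * ((Real.exp (-(β * x)) + Real.exp (-(β * y))) / 2)) with hudef
  have hu : u = s * (Real.sinh s / Real.cosh s) := by
    rw [hudef, show β * ((y - x) * (Real.exp (-(β * x)) - Real.exp (-(β * y)))) =
      (β * (y - x)) * (Real.exp (-(β * x)) - Real.exp (-(β * y))) by ring, h2s, hdiff, hsum]
    field_simp
    ring
  -- the kernel `K = G sinh s / s` (as `s K = G sinh s`) and `K ≥ G`
  set K : ℝ := duhamelKernel β x y with hKdef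
  have hKpos : 0 < K := duhamelKernel_pos β x y
  have hid := exp_sub_exp_eq_mul_duhamelKernel β x y
  rw [hdiff, h2s] at hid
  have hsK : G * Real.sinh s = s * K := by rw [hKdef]; linarith
  have hKG : G ≤ K := by
    have := exp_half_sum_le_duhamelKernel β x y
    rwa [← hGdef] at this
  -- `f_R(u)` facts
  set F : ℝ := duhamelKernel u 0 1 with hFdef
  have hFpos : 0 < F := duhamelKernel_pos u 0 1
  have huF : u * F = 1 - Real.exp (-u) := mul_duhamelKernel_zero_one u
  -- the inequality `u ≤ 2 log cosh s`, hence `e^u ≤ cosh² s`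
  have hulog : u ≤ 2 * Real.log (Real.cosh s) := by rw [hu]; exact mul_tanh_le_two_mul_log_cosh s
  have hexp : Real.exp u ≤ Real.cosh s ^ 2 := by
    have := Real.exp_le_exp.2 hulog
    rwa [two_mul, Real.exp_add, Real.exp_log hcosh, ← sq] at this
  rw [hsum]
  -- goal: `(2 G cosh s)/2 * F ≤ K`
  rcases eq_or_ne s 0 with hs0 | hs0
  · -- `s = 0`: `u = 0`, `F = 1`, `cosh 0 = 1`, `K ≥ G`
    have hu0 : u = 0 := by rw [hu, hs0]; simp
    have hF1 : F = 1 := by rw [hFdef, hu0]; exact duhamelKernel_zero_zero_one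
    rw [hF1, hs0, Real.cosh_zero]
    linarith
  · -- `s ≠ 0`: `u > 0`; multiply the claim by `u` and use `uF = 1 - e^{-u}`, `uK = G sinh² s / cosh s`
    have hupos : 0 < u := by
      rw [hu]
      rcases lt_or_gt_of_ne hs0 with hneg | hpos
      · have : Real.sinh s < 0 := Real.sinh_neg_iff.2 hneg
        have : Real.sinh s / Real.cosh s < 0 := div_neg_of_neg_of_pos this hcosh
        nlinarith
      · have : 0 < Real.sinh s := Real.sinh_pos_iff.2 hpos
        have : 0 < Real.sinh s / Real.cosh s := div_pos this hcosh
        positivity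
    -- `e^{-u} · e^{u} = 1` and `e^{u} ≤ cosh²` give `1 - e^{-u} ≤ 1 - 1/cosh² = sinh²/cosh²`
    have hEneg : 0 < Real.exp (-u) := Real.exp_pos _
    have hprod : Real.exp (-u) * Real.exp u = 1 := by rw [← Real.exp_add]; simp
    -- `(1 - e^{-u}) cosh² ≤ sinh²`
    have hkey : (1 - Real.exp (-u)) * Real.cosh s ^ 2 ≤ Real.sinh s ^ 2 := by
      have hcs : Real.cosh s ^ 2 = Real.sinh s ^ 2 + 1 := Real.cosh_sq s
      -- `cosh² - sinh² = 1 ≤ e^{-u} cosh²` since `e^{-u} cosh² ≥ e^{-u} e^{u} = 1`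
      have : 1 ≤ Real.exp (-u) * Real.cosh s ^ 2 := by
        calc (1 : ℝ) = Real.exp (-u) * Real.exp u := hprod.symm
          _ ≤ Real.exp (-u) * Real.cosh s ^ 2 := mul_le_mul_of_nonneg_left hexp hEneg.le
      nlinarith
    -- translate: `u · (G cosh s · F) = G cosh s (1 - e^{-u})` and `u · K = (s tanh s) K = G sinh s tanh s`
    have hlhs : u * (2 * G * Real.cosh s / 2 * F) = G * Real.cosh s * (1 - Real.exp (-u)) := by
      rw [← huF]; ring
    have hrhs : u * K = G * Real.sinh s * (Real.sinh s / Real.cosh s) := by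
      rw [hu, show s * (Real.sinh s / Real.cosh s) * K = (s * K) * (Real.sinh s / Real.cosh s) by ring,
        ← hsK]
    -- compare after multiplying by `u > 0`
    have hcmp : u * (2 * G * Real.cosh s / 2 * F) ≤ u * K := by
      rw [hlhs, hrhs]
      -- `G cosh (1 - e^{-u}) ≤ G sinh² / cosh` ⇔ `(1 - e^{-u}) cosh² ≤ sinh²`
      rw [show G * Real.sinh s * (Real.sinh s / Real.cosh s) = G * (Real.sinh s ^ 2 / Real.cosh s) by
        ring]
      rw [show G * Real.cosh s * (1 - Real.exp (-u)) = G * (Real.cosh s * (1 - Real.exp (-u))) by ring]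
      refine mul_le_mul_of_nonneg_left ?_ hGpos.le
      rw [le_div_iff₀ hcosh]
      nlinarith [hkey]
    exact le_of_mul_le_mul_left hcmp hupos

/-! ### Roepstorff's inequality for Gibbs states of Hermitian matrices -/

section Spectral

variable {H : Matrix n n ℂ}

/-- **Roepstorff's inequality, family form**: for Hermitian `A_k`, `β ≥ 0`, with
`g = Σ_k ⟨A_k²⟩_β`, `b = Σ_k (A_k, A_k)_β`, `c = Σ_k ⟨[A_k,[H,A_k]]⟩_β`:

  `g · f_R(βc/4g) ≤ b`,  `f_R(u) = (1 − e^{−u})/u = duhamelKernel u 0 1`.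

Proof: pair sums ([DLS1978] (35)), the per-pair inequality `half_add_mul_roepstorff_le_duhamelKernel`,
and Jensen's inequality for `exp` inside `f_R(u) = ∫₀¹ e^{−σu} dσ` with the weights
`|a^k_{ij}|²(wᵢ+wⱼ)/2 / g` ([DLS1978] proof of Prop. 3.1 with `f_R` in place of `f`).
[cite: Roepstorff1976, main inequality (as reported in DLS1978 §3 Remark 3)] [cite: DLS1978, §3 Prop. 3.1, Remark 3 (36)–(37)] -/
theorem roepstorff_sum_le (hH : H.IsHermitian) {β : ℝ} (hβ : 0 ≤ β) {ι : Type*} [Fintype ι]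
    {A : ι → Matrix n n ℂ} (hA : ∀ k, (A k).IsHermitian) :
    (∑ k, (gibbsState β H (A k * A k)).re) *
        duhamelKernel (β * (∑ k, (gibbsState β H (A k * (H * A k - A k * H) - (H * A k - A k * H) * A k)).re) /
          (4 * ∑ k, (gibbsState β H (A k * A k)).re)) 0 1 ≤
      ∑ k, (duhamel β H (A k) (A k)).re := by
  -- abbreviations (as in `falkBruch_sum_le`)
  set E := hH.eigenvalues with hE
  set W : n → ℝ := fun i => Real.exp (-(β * E i)) with hW
  set Zr : ℝ := ∑ i, W i with hZr
  set m : ι → n → n → ℝ := fun k i j => ‖(star (hH.eigenvectorUnitary : Matrix n n ℂ) * A k *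
    (hH.eigenvectorUnitary : Matrix n n ℂ)) i j‖ ^ 2 with hm
  set K : n → n → ℝ := fun i j => duhamelKernel β (E i) (E j) with hK
  set c : n → n → ℝ := fun i j => (E j - E i) * (W i - W j) with hc
  have hm0 : ∀ k i j, 0 ≤ m k i j := fun k i j => sq_nonneg _
  have hK0 : ∀ i j, 0 ≤ K i j := fun i j => (duhamelKernel_pos β _ _).le
  have hc0 : ∀ i j, 0 ≤ c i j := fun i j => sub_mul_exp_sub_exp_nonneg hβ (E i) (E j)
  have hW0 : ∀ i, 0 < W i := fun i => Real.exp_pos _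
  have hmsymm : ∀ k i j, m k i j = m k j i := by
    intro k i j
    simp only [hm]
    rw [← star_apply_rotate (hA k) i j, norm_star]
  have hg : ∑ k, (gibbsState β H (A k * A k)).re = Zr⁻¹ * ∑ k, ∑ i, ∑ j, m k i j * W i := by
    rw [mul_sum]
    exact sum_congr rfl fun k _ => hH.re_gibbsState_sq (hA k) β
  have hb : ∑ k, (duhamel β H (A k) (A k)).re = Zr⁻¹ * ∑ k, ∑ i, ∑ j, m k i j * K i j := by
    rw [mul_sum]
    exact sum_congr rfl fun k _ => hH.re_duhamel_self (hA k) β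
  have hcc : ∑ k, (gibbsState β H (A k * (H * A k - A k * H) - (H * A k - A k * H) * A k)).re =
      Zr⁻¹ * ∑ k, ∑ i, ∑ j, m k i j * c i j := by
    rw [mul_sum]
    exact sum_congr rfl fun k _ => hH.re_gibbsState_doubleComm (hA k) β
  rw [hg, hb, hcc]
  set G : ℝ := ∑ k, ∑ i, ∑ j, m k i j * W i with hG
  set B : ℝ := ∑ k, ∑ i, ∑ j, m k i j * K i j with hB
  set C : ℝ := ∑ k, ∑ i, ∑ j, m k i j * c i j with hC
  have hB0 : 0 ≤ B := sum_nonneg fun k _ => sum_nonneg fun i _ => sum_nonneg fun j _ =>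
    mul_nonneg (hm0 k i j) (hK0 i j)
  have hG0 : 0 ≤ G := sum_nonneg fun k _ => sum_nonneg fun i _ => sum_nonneg fun j _ =>
    mul_nonneg (hm0 k i j) (hW0 i).le
  -- degenerate normalisations
  have hZinv : (0 : ℝ) ≤ Zr⁻¹ := inv_nonneg.2 (sum_nonneg fun i _ => (hW0 i).le)
  rcases hZinv.eq_or_lt with hZ0 | hZpos
  · rw [← hZ0]; simp
  rcases hG0.eq_or_lt with hGz | hGpos
  · rw [← hGz]; simp only [mul_zero, zero_mul]; exact mul_nonneg hZpos.le hB0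
  -- the argument `u = β C / (4 G)` (the `Zr⁻¹` cancel)
  have hZne : Zr ≠ 0 := (inv_pos.1 hZpos).ne'
  have hu : β * (Zr⁻¹ * C) / (4 * (Zr⁻¹ * G)) = β * C / (4 * G) := by
    field_simp
  rw [hu]
  -- symmetrised `G` and the pair quantities
  set gp : ι × n × n → ℝ := fun p => m p.1 p.2.1 p.2.2 * ((W p.2.1 + W p.2.2) / 2) with hgp
  set up : ι × n × n → ℝ := fun p => β * ((E p.2.2 - E p.2.1) * (W p.2.1 - W p.2.2)) /
    (4 * ((W p.2.1 + W p.2.2) / 2)) with hup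
  have hgp0 : ∀ p, 0 ≤ gp p := fun p => mul_nonneg (hm0 _ _ _) (by linarith [hW0 p.2.1, hW0 p.2.2])
  have hGsymm : G = ∑ p, gp p := by
    have : ∀ k, ∑ i, ∑ j, m k i j * W i = ∑ i, ∑ j, m k i j * W j := by
      intro k
      rw [Finset.sum_comm]
      exact sum_congr rfl fun i _ => sum_congr rfl fun j _ => by rw [hmsymm k j i]
    rw [hgp, Fintype.sum_prod_type, hG]
    refine sum_congr rfl fun k _ => ?_
    rw [Fintype.sum_prod_type]
    have h2 : ∑ i, ∑ j, m k i j * ((W i + W j) / 2) =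
        (∑ i, ∑ j, m k i j * W i + ∑ i, ∑ j, m k i j * W j) / 2 := by
      rw [← sum_add_distrib, Finset.sum_div]
      refine sum_congr rfl fun i _ => ?_
      rw [← sum_add_distrib, Finset.sum_div]
      refine sum_congr rfl fun j _ => ?_
      ring
    rw [h2, ← this]
    ring
  -- `Σ gp·up = β C / 4`
  have hsum_u : ∑ p, gp p * up p = β * C / 4 := by
    have : ∀ p : ι × n × n, gp p * up p = β / 4 * (m p.1 p.2.1 p.2.2 * c p.2.1 p.2.2) := by
      intro p
      simp only [hgp, hup, hc]
      have hne : W p.2.1 + W p.2.2 ≠ 0 := (by linarith [hW0 p.2.1, hW0 p.2.2] : (0:ℝ) < W p.2.1 + W p.2.2).ne'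
      field_simp
    simp_rw [this]
    rw [← mul_sum, hC, Fintype.sum_prod_type]
    simp only [Fintype.sum_prod_type]
    ring
  have hB' : B = ∑ p : ι × n × n, m p.1 p.2.1 p.2.2 * K p.2.1 p.2.2 := by
    rw [hB]; simp only [Fintype.sum_prod_type]
  -- Step 1 (per pair): `Σ gp · f_R(up) ≤ B`
  have hstep1 : ∑ p : ι × n × n, gp p * duhamelKernel (up p) 0 1 ≤ B := by
    rw [hB']
    refine sum_le_sum fun p _ => ?_
    have hp := half_add_mul_roepstorff_le_duhamelKernel β (E p.2.1) (E p.2.2)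
    simp only [hgp, hup, hK, hW]
    rw [mul_assoc]
    exact mul_le_mul_of_nonneg_left hp (hm0 _ _ _)
  -- Step 2 (Jensen for `exp` inside the integral): `G · f_R(βC/4G) ≤ Σ gp · f_R(up)`
  have hstep2 : G * duhamelKernel (β * C / (4 * G)) 0 1 ≤
      ∑ p : ι × n × n, gp p * duhamelKernel (up p) 0 1 := by
    -- weights
    set w : ι × n × n → ℝ := fun p => gp p / G with hw
    have hw0 : ∀ p, 0 ≤ w p := fun p => div_nonneg (hgp0 p) hGpos.le
    have hw1 : ∑ p, w p = 1 := by
      rw [hw]; simp only []; rw [← Finset.sum_div, ← hGsymm, div_self hGpos.ne']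
    have hwu : ∑ p, w p * up p = β * C / (4 * G) := by
      have : ∀ p, w p * up p = (gp p * up p) / G := fun p => by rw [hw]; ring
      simp_rw [this]
      rw [← Finset.sum_div, hsum_u]
      field_simp
    -- pointwise in `σ`: `G e^{-σ u} ≤ Σ gp e^{-σ up}`
    have hpt : ∀ σ : ℝ, G * Real.exp (-(β * C / (4 * G) * σ)) ≤
        ∑ p, gp p * Real.exp (-(up p * σ)) := by
      intro σ
      have hJ := (convexOn_exp).map_sum_le (t := (univ : Finset (ι × n × n))) (w := w)
        (p := fun p => -(up p * σ)) (fun p _ => hw0 p) hw1 (fun p _ => Set.mem_univ _)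
      simp only [smul_eq_mul] at hJ
      have harg : ∑ p, w p * -(up p * σ) = -(β * C / (4 * G) * σ) := by
        calc ∑ p, w p * -(up p * σ) = ∑ p, (-σ) * (w p * up p) :=
              sum_congr rfl fun p _ => by ring
          _ = (-σ) * ∑ p, w p * up p := by rw [Finset.mul_sum]
          _ = -(β * C / (4 * G) * σ) := by rw [hwu]; ring
      rw [harg] at hJ
      have h2 : G * ∑ p, w p * Real.exp (-(up p * σ)) = ∑ p, gp p * Real.exp (-(up p * σ)) := by
        rw [Finset.mul_sum]
        refine sum_congr rfl fun p _ => ?_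
        rw [hw]
        field_simp
      calc G * Real.exp (-(β * C / (4 * G) * σ))
          ≤ G * ∑ p, w p * Real.exp (-(up p * σ)) := mul_le_mul_of_nonneg_left hJ hGpos.le
        _ = ∑ p, gp p * Real.exp (-(up p * σ)) := h2
    -- integrate over `σ ∈ [0,1]`
    have hint : ∀ p : ι × n × n, IntervalIntegrable (fun σ : ℝ => gp p * Real.exp (-(up p * σ))) volume 0 1 :=
      fun p => (Continuous.intervalIntegrable (by fun_prop) _ _)
    calc G * duhamelKernel (β * C / (4 * G)) 0 1
        = ∫ σ in (0 : ℝ)..1, G * Real.exp (-(β * C / (4 * G) * σ)) := by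
          rw [duhamelKernel_zero_one_eq, intervalIntegral.integral_const_mul]
      _ ≤ ∫ σ in (0 : ℝ)..1, ∑ p, gp p * Real.exp (-(up p * σ)) := by
          exact intervalIntegral.integral_mono_on zero_le_one
            (Continuous.intervalIntegrable (by fun_prop) _ _)
            (Continuous.intervalIntegrable (continuous_finsetSum _ fun p _ => by fun_prop) _ _)
            fun σ _ => hpt σ
      _ = ∑ p, ∫ σ in (0 : ℝ)..1, gp p * Real.exp (-(up p * σ)) :=
          intervalIntegral.integral_finsetSum fun p _ => hint p
      _ = ∑ p, gp p * duhamelKernel (up p) 0 1 := by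
          refine sum_congr rfl fun p _ => ?_
          rw [intervalIntegral.integral_const_mul, duhamelKernel_zero_one_eq]
  -- assemble and normalise
  have hmain : G * duhamelKernel (β * C / (4 * G)) 0 1 ≤ B := hstep2.trans hstep1
  calc Zr⁻¹ * G * duhamelKernel (β * C / (4 * G)) 0 1
      = Zr⁻¹ * (G * duhamelKernel (β * C / (4 * G)) 0 1) := by ring
    _ ≤ Zr⁻¹ * B := mul_le_mul_of_nonneg_left hmain hZpos.le

/-- **Roepstorff's inequality, single observable**: for Hermitian `A`, `β ≥ 0`, with `g = ⟨A²⟩_β`,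
`b = (A,A)_β`, `c = ⟨[A,[H,A]]⟩_β`: `g · f_R(βc/4g) ≤ b`, `f_R(u) = (1 − e^{−u})/u = duhamelKernel u 0 1`.
[cite: Roepstorff1976, main inequality (as reported in DLS1978 §3 Remark 3)] [cite: DLS1978, §3 Remark 3 (36)–(37)] -/
theorem IsHermitian.gibbsState_sq_mul_roepstorff_le_duhamel (hH : H.IsHermitian) {β : ℝ} (hβ : 0 ≤ β)
    {A : Matrix n n ℂ} (hA : A.IsHermitian) :
    (gibbsState β H (A * A)).re *
        duhamelKernel (β * (gibbsState β H (A * (H * A - A * H) - (H * A - A * H) * A)).re /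
          (4 * (gibbsState β H (A * A)).re)) 0 1 ≤
      (duhamel β H A A).re := by
  have h := roepstorff_sum_le hH hβ (ι := Unit) (A := fun _ => A) fun _ => hA
  simpa using h

/-- **Division form with the closed expression**: if `g > 0` and `c > 0` then
`(4g²/(βc)) · (1 − e^{−βc/(4g)}) ≤ b` (for `β > 0`). [cite: Roepstorff1976, main inequality (as reported in DLS1978 §3 Remark 3)]
[cite: DLS1978, §3 Remark 3 (36)] -/
theorem IsHermitian.roepstorff_closed_form_le_duhamel (hH : H.IsHermitian) {β : ℝ} (hβ : 0 < β)
    {A : Matrix n n ℂ} (hA : A.IsHermitian)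
    (hg : 0 < (gibbsState β H (A * A)).re)
    (hc : 0 < (gibbsState β H (A * (H * A - A * H) - (H * A - A * H) * A)).re) :
    4 * (gibbsState β H (A * A)).re ^ 2 /
          (β * (gibbsState β H (A * (H * A - A * H) - (H * A - A * H) * A)).re) *
        (1 - Real.exp (-(β * (gibbsState β H (A * (H * A - A * H) - (H * A - A * H) * A)).re /
          (4 * (gibbsState β H (A * A)).re)))) ≤
      (duhamel β H A A).re := by
  have h := hH.gibbsState_sq_mul_roepstorff_le_duhamel hβ.le hA
  set g := (gibbsState β H (A * A)).re
  set c := (gibbsState β H (A * (H * A - A * H) - (H * A - A * H) * A)).re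
  set u : ℝ := β * c / (4 * g) with hu
  have hupos : 0 < u := by rw [hu]; positivity
  have huF := mul_duhamelKernel_zero_one u
  -- `g · F = g · (1 - e^{-u})/u = (4 g² /(β c)) (1 - e^{-u})`
  have hF : duhamelKernel u 0 1 = (1 - Real.exp (-u)) / u := by
    rw [eq_div_iff hupos.ne']; linarith
  rw [hF] at h
  have hrew : g * ((1 - Real.exp (-u)) / u) = 4 * g ^ 2 / (β * c) * (1 - Real.exp (-u)) := by
    rw [hu]; field_simp
  linarith [hrew]

end Spectral

end Matrix
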